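import Mathlib
import Summits.MatrixMultiplication.MatrixMultiplication.Theorems.ThresholdSubsetTriples.Negative.GenusCertificateRules
import Summits.MatrixMultiplication.MatrixMultiplication.Theorems.ThresholdSubsetTriples.Negative.BlockPermCount
import Summits.MatrixMultiplication.MatrixMultiplication.Theorems.ThresholdSubsetTriples.Negative.SymmetricAnsatz
import Summits.MatrixMultiplication.MatrixMultiplication.Theorems.ThresholdSubsetTriples.Negative.GenusBlockAsymptotics

/-!
# `ThresholdSubsetTriples` (crux stmt-MatrixMultiplication-10882), line `SketchIdeator6`:
# the genus certificate has NO block-structured threshold designs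

Negative-side result (line lead c6, 2026-08-17; `sorry`-free, standard axioms).  The open design stub
`stub_genusThreshold` (C⁺ = GenusThreshold) of line `SketchIdeator6` asks, for every `c > 0` and
cofinally in `n`, for GENUS-CERTIFIED triples `S, T, U ⊆ S_n` — pairwise quotient-disjoint, and every
triple of non-trivial quotients `q₁, q₂, q₃` satisfies `n + 2·orb⟨q₁,q₂,q₃⟩ < cyc q₁ + cyc q₂ + cyc q₃`
— of volume `|S||T||U| > (n!)^{3/2} e^{-c√n}`.  This file refutes the stub on the whole BLOCK-STRUCTURED
world: witnesses in which the quotient set `Q(X) = X X⁻¹` of each set preserves a labelling of `Fin n`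
with blocks of at most `B` points (each set inside a coset of a Young subgroup with blocks `≤ B`; three
independent labellings), for any `B` with `(16B)^4 ≤ n^3`, i.e. `B ≤ n^{3/4}/16`.  This class contains,
at block size `Θ(√n)`, every Young design and the Cohn–Umans triangle (the only constructions known
within `e^{-O(n)}` of the packing bound for the TPP itself); for the genus certificate they are capped
at `(n!)^{1+o(1)}`, a full factor `√(n!)` below the threshold:

* `volume_mul_factorial_le_of_blockStructured` — for such a certified triple with `|S|,|T|,|U| ≥ 2`:
  `|S||T||U| · (2n)! ≤ (n+1)^3 · (4nB)^{2n}`  (so `|S||T||U| ≤ (n+1)^3 (2eB)^{2n}` by Stirling).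
  Proof: the cycle-count inequality N1 (`Negative.three_le_cyc_add`) at the three cycle-MINIMISING
  non-trivial quotients gives `J_S + J_T + J_U ≤ 2n − 3`, `J_X := n − min cyc`; every element of `X`
  differs from a fixed one by a block-preserving permutation with `≥ n − J_X` cycles, and those are
  counted by `Negative.card_mul_factorial_le_of_blockQuotients` (`|X| · J_X! ≤ (n+1)(nB)^{J_X}`);
  a trinomial bound and `(2n)!/J! ≤ (2n)^{2n−J}` assemble the three.
* the asymptotics (`Negative.le_threshold_of_volume_mul_factorial_le`, file `GenusBlockAsymptotics.lean`):
  that bound and `(16B)^4 ≤ n^3` force `|S||T||U| ≤ (n!)^{3/2} e^{-c√n}` for `n ≥ n₀(c)` (Stirling).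
* `not_genusThreshold_blockStructured` — the stub's signature VERBATIM plus one conjunct (the block
  structure) is false (degenerate sizes `|X| ≤ 1` by pairwise packing `card_mul_card_le_factorial` and
  `Negative.factorial_le_threshold`).

Consequences for the line (crux workfile `Census-c6b-GenusCalibration.md`): a witness for C⁺ must have,
in at least one of its three sets, quotients that do not sit in any Young coset with blocks `≤ n^{3/4}/16`
— it cannot be a (thinned, relabelled, translated) grid/Young design; the certificate's design space is
disjoint from everything known near the TPP packing bound.

References: Cohn–Umans 2003 §7; Blasiak–Church–Cohn–Grochow–Umans 2017 (arXiv:1712.02302) §4;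
Lando–Zvonkin, *Graphs on Surfaces* Ch. 1; crux workfiles `Lines/SketchIdeator6.lean` (skeleton v4),
`Census-a4-GenusCertificate.md`, `Census-c6b-GenusCalibration.md`.
-/

set_option linter.dupNamespace false

open scoped Classical

namespace Summit.MatrixMultiplication.MatrixMultiplication.Theorems.ThresholdSubsetTriples.Negative

section BlockVolume

open MulAction Equiv Equiv.Perm Finset

variable {n : ℕ}

/-- **Pairwise packing.**  If the quotient sets of `S` and `T` meet only in `1` (first pairwise clause of
the stub), then `(s, t) ↦ s⁻¹ t` is injective, so `|S|·|T| ≤ n!`. -/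
theorem card_mul_card_le_factorial {S T : Finset (Perm (Fin n))}
    (hST : ∀ s ∈ S, ∀ s' ∈ S, ∀ t ∈ T, ∀ t' ∈ T, s * s'⁻¹ = t * t'⁻¹ → s = s' ∧ t = t') :
    S.card * T.card ≤ n.factorial := by
  have h := card_le_card_of_injOn (s := S ×ˢ T) (t := (univ : Finset (Perm (Fin n))))
    (fun p => p.1⁻¹ * p.2) (fun _ _ => mem_coe.2 (mem_univ _)) ?_
  · simpa [card_product, card_univ, Fintype.card_perm, Fintype.card_fin] using h
  · rintro ⟨s, t⟩ hst ⟨s', t'⟩ hst' h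
    simp only [coe_product, Set.mem_prod, mem_coe] at hst hst'
    simp only at h
    have hq : s' * s⁻¹ = t' * t⁻¹ := by
      calc s' * s⁻¹ = s' * (s⁻¹ * t) * t⁻¹ := by group
        _ = s' * (s'⁻¹ * t') * t⁻¹ := by rw [h]
        _ = t' * t⁻¹ := by group
    obtain ⟨h1, h2⟩ := hST s' hst'.1 s hst.1 t' hst'.2 t hst.2 hq
    rw [h1, h2]

/-- `(a+b)! ≤ 2^(a+b) · a! · b!` (a binomial coefficient is at most `2^(a+b)`). -/
theorem factorial_add_le_two_pow_mul (a b : ℕ) :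
    (a + b).factorial ≤ 2 ^ (a + b) * (a.factorial * b.factorial) := by
  have h := Nat.add_choose_mul_factorial_mul_factorial a b
  have hc : (a + b).choose b ≤ 2 ^ (a + b) := Nat.choose_le_two_pow _ _
  calc (a + b).factorial = (a + b).choose b * a.factorial * b.factorial := h.symm
    _ ≤ 2 ^ (a + b) * a.factorial * b.factorial := by gcongr
    _ = 2 ^ (a + b) * (a.factorial * b.factorial) := by ring

/-- `(a+b+c)! ≤ 4^(a+b+c) · a! · b! · c!` (a trinomial coefficient is at most `4^(a+b+c)`). -/
theorem factorial_add_add_le_four_pow_mul (a b c : ℕ) :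
    (a + b + c).factorial ≤ 4 ^ (a + b + c) * (a.factorial * b.factorial * c.factorial) := by
  have h1 := factorial_add_le_two_pow_mul (a + b) c
  have h2 := factorial_add_le_two_pow_mul a b
  have h3 : 2 ^ (a + b) ≤ 2 ^ (a + b + c) := Nat.pow_le_pow_right (by norm_num) (by omega)
  have h4 : (4 : ℕ) ^ (a + b + c) = 2 ^ (a + b + c) * 2 ^ (a + b + c) := by
    rw [← mul_pow]; norm_num
  calc (a + b + c).factorial ≤ 2 ^ (a + b + c) * ((a + b).factorial * c.factorial) := h1
    _ ≤ 2 ^ (a + b + c) * ((2 ^ (a + b) * (a.factorial * b.factorial)) * c.factorial) := by gcongr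
    _ ≤ 2 ^ (a + b + c) * ((2 ^ (a + b + c) * (a.factorial * b.factorial)) * c.factorial) := by gcongr
    _ = 4 ^ (a + b + c) * (a.factorial * b.factorial * c.factorial) := by rw [h4]; ring

/-- **Volume of a block-structured genus-certified triple (cleared, in `ℕ`).**  Let `S, T, U ⊆ S_n` each
have at least two elements, let the quotients of each set preserve a labelling of `Fin n` whose blocks
have at most `B` points (three independent labellings: each set lies in a coset of a Young subgroup
with blocks `≤ B`), and let every triple of non-trivial quotients pass the genus certificate of
`stub_genusThreshold`.  Then `|S||T||U| · (2n)! ≤ (n+1)³ · (4nB)^(2n)`.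

Proof: N1 (`three_le_cyc_add`) at the three cycle-minimising quotients gives `J_S + J_T + J_U ≤ 2n − 3`
for `J_X = n − (min cycle count of a non-trivial quotient of X)`; `card_mul_factorial_le_of_blockQuotients`
gives `|X| · J_X! ≤ (n+1)(nB)^{J_X}`; the trinomial bound and `(2n)!/J! ≤ (2n)^{2n−J}` finish. -/
theorem volume_mul_factorial_le_of_blockStructured (S T U : Finset (Perm (Fin n))) (B : ℕ)
    (lS lT lU : Fin n → Fin n)
    (hBS : ∀ i : Fin n, (univ.filter (fun x : Fin n => lS x = i)).card ≤ B)
    (hBT : ∀ i : Fin n, (univ.filter (fun x : Fin n => lT x = i)).card ≤ B)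
    (hBU : ∀ i : Fin n, (univ.filter (fun x : Fin n => lU x = i)).card ≤ B)
    (hlS : ∀ s ∈ S, ∀ s' ∈ S, ∀ x, lS ((s * s'⁻¹) x) = lS x)
    (hlT : ∀ t ∈ T, ∀ t' ∈ T, ∀ x, lT ((t * t'⁻¹) x) = lT x)
    (hlU : ∀ u ∈ U, ∀ u' ∈ U, ∀ x, lU ((u * u'⁻¹) x) = lU x)
    (h3 : ∀ s ∈ S, ∀ s' ∈ S, ∀ t ∈ T, ∀ t' ∈ T, ∀ u ∈ U, ∀ u' ∈ U, s ≠ s' → t ≠ t' → u ≠ u' →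
      n + 2 * Nat.card (orbitRel.Quotient (Subgroup.closure
        ({s * s'⁻¹, t * t'⁻¹, u * u'⁻¹} : Set (Perm (Fin n)))) (Fin n)) <
      Nat.card (orbitRel.Quotient (Subgroup.zpowers (s * s'⁻¹)) (Fin n)) +
      Nat.card (orbitRel.Quotient (Subgroup.zpowers (t * t'⁻¹)) (Fin n)) +
      Nat.card (orbitRel.Quotient (Subgroup.zpowers (u * u'⁻¹)) (Fin n)))
    (hS : 1 < S.card) (hT : 1 < T.card) (hU : 1 < U.card) :
    S.card * T.card * U.card * (2 * n).factorial ≤ (n + 1) ^ 3 * (4 * n * B) ^ (2 * n) := by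
  -- `n ≥ 1` and `B ≥ 1`
  have hn : 0 < n := by
    rcases Nat.eq_zero_or_pos n with hn0 | hn0
    · subst hn0
      have : S.card ≤ 1 := by
        have h := card_le_univ S
        simpa [Fintype.card_perm, Fintype.card_fin] using h
      omega
    · exact hn0
  have hB : 1 ≤ B := by
    have h := hBS (lS ⟨0, hn⟩)
    have h1 : 1 ≤ (univ.filter (fun x : Fin n => lS x = lS ⟨0, hn⟩)).card :=
      card_pos.2 ⟨⟨0, hn⟩, by simp⟩
    exact h1.trans h
  -- cycle-minimising non-trivial quotients
  obtain ⟨⟨s₁, s₂⟩, hsm, hsmin⟩ := exists_min_image S.offDiag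
    (fun p : Perm (Fin n) × Perm (Fin n) =>
      Nat.card (orbitRel.Quotient (Subgroup.zpowers (p.1 * p.2⁻¹)) (Fin n)))
    (by obtain ⟨a, ha, b, hb, hab⟩ := one_lt_card.1 hS; exact ⟨(a, b), mem_offDiag.2 ⟨ha, hb, hab⟩⟩)
  obtain ⟨⟨t₁, t₂⟩, htm, htmin⟩ := exists_min_image T.offDiag
    (fun p : Perm (Fin n) × Perm (Fin n) =>
      Nat.card (orbitRel.Quotient (Subgroup.zpowers (p.1 * p.2⁻¹)) (Fin n)))
    (by obtain ⟨a, ha, b, hb, hab⟩ := one_lt_card.1 hT; exact ⟨(a, b), mem_offDiag.2 ⟨ha, hb, hab⟩⟩)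
  obtain ⟨⟨u₁, u₂⟩, hum, humin⟩ := exists_min_image U.offDiag
    (fun p : Perm (Fin n) × Perm (Fin n) =>
      Nat.card (orbitRel.Quotient (Subgroup.zpowers (p.1 * p.2⁻¹)) (Fin n)))
    (by obtain ⟨a, ha, b, hb, hab⟩ := one_lt_card.1 hU; exact ⟨(a, b), mem_offDiag.2 ⟨ha, hb, hab⟩⟩)
  simp only [mem_offDiag] at hsm htm hum
  set cS := Nat.card (orbitRel.Quotient (Subgroup.zpowers (s₁ * s₂⁻¹)) (Fin n)) with hcS
  set cT := Nat.card (orbitRel.Quotient (Subgroup.zpowers (t₁ * t₂⁻¹)) (Fin n)) with hcT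
  set cU := Nat.card (orbitRel.Quotient (Subgroup.zpowers (u₁ * u₂⁻¹)) (Fin n)) with hcU
  have hcSn : cS ≤ n := orbitQuotient_card_le_n _
  have hcTn : cT ≤ n := orbitQuotient_card_le_n _
  have hcUn : cU ≤ n := orbitQuotient_card_le_n _
  -- N1 at the minimisers
  have hN1 : n + 3 ≤ cS + cT + cU :=
    three_le_cyc_add _ _ _ (h3 s₁ hsm.1 s₂ hsm.2.1 t₁ htm.1 t₂ htm.2.1 u₁ hum.1 u₂ hum.2.1
      hsm.2.2 htm.2.2 hum.2.2)
  -- the per-set bounds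
  have hXS : S.card * (n - cS).factorial ≤ (n + 1) * (n * B) ^ (n - cS) := by
    have h := card_mul_factorial_le_of_blockQuotients S lS B hBS hlS (n - cS)
      ((Nat.sub_le n cS).trans (Nat.le_mul_of_pos_right n hB)) (fun s hs s' hs' hne => by
        have := hsmin ⟨s, s'⟩ (mem_offDiag.2 ⟨hs, hs', hne⟩)
        simp only at this
        omega)
    exact h.trans (Nat.mul_le_mul_right _ (by omega))
  have hXT : T.card * (n - cT).factorial ≤ (n + 1) * (n * B) ^ (n - cT) := by
    have h := card_mul_factorial_le_of_blockQuotients T lT B hBT hlT (n - cT)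
      ((Nat.sub_le n cT).trans (Nat.le_mul_of_pos_right n hB)) (fun t ht t' ht' hne => by
        have := htmin ⟨t, t'⟩ (mem_offDiag.2 ⟨ht, ht', hne⟩)
        simp only at this
        omega)
    exact h.trans (Nat.mul_le_mul_right _ (by omega))
  have hXU : U.card * (n - cU).factorial ≤ (n + 1) * (n * B) ^ (n - cU) := by
    have h := card_mul_factorial_le_of_blockQuotients U lU B hBU hlU (n - cU)
      ((Nat.sub_le n cU).trans (Nat.le_mul_of_pos_right n hB)) (fun u hu u' hu' hne => by
        have := humin ⟨u, u'⟩ (mem_offDiag.2 ⟨hu, hu', hne⟩)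
        simp only at this
        omega)
    exact h.trans (Nat.mul_le_mul_right _ (by omega))
  -- combine
  set JS := n - cS with hJS
  set JT := n - cT with hJT
  set JU := n - cU with hJU
  set Jt := JS + JT + JU with hJt
  have hJt : Jt + 3 ≤ 2 * n := by omega
  have hprod : S.card * T.card * U.card * (JS.factorial * JT.factorial * JU.factorial) ≤
      (n + 1) ^ 3 * (n * B) ^ Jt := by
    calc S.card * T.card * U.card * (JS.factorial * JT.factorial * JU.factorial)
        = (S.card * JS.factorial) * (T.card * JT.factorial) * (U.card * JU.factorial) := by ring
      _ ≤ ((n + 1) * (n * B) ^ JS) * ((n + 1) * (n * B) ^ JT) * ((n + 1) * (n * B) ^ JU) :=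
          Nat.mul_le_mul (Nat.mul_le_mul hXS hXT) hXU
      _ = (n + 1) ^ 3 * (n * B) ^ Jt := by rw [show Jt = JS + JT + JU from rfl, pow_add, pow_add]; ring
  have hfac : Jt.factorial ≤ 4 ^ Jt * (JS.factorial * JT.factorial * JU.factorial) :=
    factorial_add_add_le_four_pow_mul JS JT JU
  have hVJ : S.card * T.card * U.card * Jt.factorial ≤ (n + 1) ^ 3 * (4 * n * B) ^ Jt := by
    calc S.card * T.card * U.card * Jt.factorial
        ≤ S.card * T.card * U.card * (4 ^ Jt * (JS.factorial * JT.factorial * JU.factorial)) :=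
          Nat.mul_le_mul_left _ hfac
      _ = 4 ^ Jt * (S.card * T.card * U.card * (JS.factorial * JT.factorial * JU.factorial)) := by ring
      _ ≤ 4 ^ Jt * ((n + 1) ^ 3 * (n * B) ^ Jt) := Nat.mul_le_mul_left _ hprod
      _ = (n + 1) ^ 3 * (4 * n * B) ^ Jt := by rw [mul_assoc 4 n B, mul_pow]; ring
  -- `(2n)! = Jt! · (2n).descFactorial (2n − Jt)` and the descending factorial is `≤ (4nB)^(2n−Jt)`
  have hJt2 : Jt ≤ 2 * n := by omega
  have hdesc : (2 * n).factorial = Jt.factorial * (2 * n).descFactorial (2 * n - Jt) := by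
    have h := Nat.factorial_mul_descFactorial (Nat.sub_le (2 * n) Jt)
    rw [Nat.sub_sub_self hJt2] at h
    exact h.symm
  have hdle : (2 * n).descFactorial (2 * n - Jt) ≤ (4 * n * B) ^ (2 * n - Jt) :=
    (Nat.descFactorial_le_pow _ _).trans (Nat.pow_le_pow_left (by nlinarith) _)
  calc S.card * T.card * U.card * (2 * n).factorial
      = (S.card * T.card * U.card * Jt.factorial) * (2 * n).descFactorial (2 * n - Jt) := by
        rw [hdesc]; ring
    _ ≤ ((n + 1) ^ 3 * (4 * n * B) ^ Jt) * (4 * n * B) ^ (2 * n - Jt) := Nat.mul_le_mul hVJ hdle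
    _ = (n + 1) ^ 3 * (4 * n * B) ^ (2 * n) := by
        rw [mul_assoc, ← pow_add, Nat.add_sub_cancel' hJt2]

end BlockVolume




section Final

open MulAction Equiv Equiv.Perm Finset

/-- **`GenusThreshold` has no block-structured witnesses.**  The design stub `stub_genusThreshold` of
line `SketchIdeator6`, restricted to witnesses in which the quotient set of each of `S, T, U`
preserves some labelling of `Fin n` with blocks of at most `B` points, `(16B)^4 ≤ n^3` — i.e. each set
lies in a coset of a Young subgroup with blocks `≤ n^{3/4}/16`, which covers the scale `Θ(√n)` of the
Cohn–Umans triangle and of every Young design — is FALSE: such genus-certified triples have volume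
`≤ (n!)^{3/2} e^{-c√n}` for every `c` and all large `n` (indeed `≤ (n+1)^3 (2eB)^{2n}/…`, see
`volume_mul_factorial_le_of_blockStructured`).  The statement below is the stub's signature verbatim
with ONE extra conjunct (the block structure). -/
theorem not_genusThreshold_blockStructured :
    ¬ (∀ c : ℝ, 0 < c → ∀ n₀ : ℕ, ∃ n ≥ n₀, ∃ S T U : Finset (Equiv.Perm (Fin n)),
      (∃ B : ℕ, ∃ lS lT lU : Fin n → Fin n, (16 * B) ^ 4 ≤ n ^ 3 ∧
        (∀ i : Fin n, (Finset.univ.filter (fun x : Fin n => lS x = i)).card ≤ B) ∧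
        (∀ i : Fin n, (Finset.univ.filter (fun x : Fin n => lT x = i)).card ≤ B) ∧
        (∀ i : Fin n, (Finset.univ.filter (fun x : Fin n => lU x = i)).card ≤ B) ∧
        (∀ s ∈ S, ∀ s' ∈ S, ∀ x, lS ((s * s'⁻¹) x) = lS x) ∧
        (∀ t ∈ T, ∀ t' ∈ T, ∀ x, lT ((t * t'⁻¹) x) = lT x) ∧
        (∀ u ∈ U, ∀ u' ∈ U, ∀ x, lU ((u * u'⁻¹) x) = lU x)) ∧
      (∀ s ∈ S, ∀ s' ∈ S, ∀ t ∈ T, ∀ t' ∈ T, s * s'⁻¹ = t * t'⁻¹ → s = s' ∧ t = t') ∧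
      (∀ t ∈ T, ∀ t' ∈ T, ∀ u ∈ U, ∀ u' ∈ U, t * t'⁻¹ = u * u'⁻¹ → t = t' ∧ u = u') ∧
      (∀ u ∈ U, ∀ u' ∈ U, ∀ s ∈ S, ∀ s' ∈ S, u * u'⁻¹ = s * s'⁻¹ → u = u' ∧ s = s') ∧
      (∀ s ∈ S, ∀ s' ∈ S, ∀ t ∈ T, ∀ t' ∈ T, ∀ u ∈ U, ∀ u' ∈ U, s ≠ s' → t ≠ t' → u ≠ u' →
        n + 2 * Nat.card (MulAction.orbitRel.Quotient (Subgroup.closure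
          ({s * s'⁻¹, t * t'⁻¹, u * u'⁻¹} : Set (Equiv.Perm (Fin n)))) (Fin n)) <
        Nat.card (MulAction.orbitRel.Quotient (Subgroup.zpowers (s * s'⁻¹)) (Fin n)) +
        Nat.card (MulAction.orbitRel.Quotient (Subgroup.zpowers (t * t'⁻¹)) (Fin n)) +
        Nat.card (MulAction.orbitRel.Quotient (Subgroup.zpowers (u * u'⁻¹)) (Fin n))) ∧
      (n.factorial : ℝ) ^ ((3 : ℝ) / 2) * Real.exp (-(c * Real.sqrt (n : ℝ))) <
        ((S.card * T.card * U.card : ℕ) : ℝ)) := by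
  intro h
  obtain ⟨n₁, h₁⟩ := le_threshold_of_volume_mul_factorial_le (c := 1) zero_le_one
  obtain ⟨n₂, h₂⟩ := factorial_le_threshold (c := 1) zero_le_one
  obtain ⟨n, hn, S, T, U, ⟨B, lS, lT, lU, hB, hBS, hBT, hBU, hlS, hlT, hlU⟩, hST, hTU, hUS, h3, hvol⟩ :=
    h 1 one_pos (max n₁ n₂)
  have hn₁ : n₁ ≤ n := le_trans (le_max_left _ _) hn
  have hn₂ : n₂ ≤ n := le_trans (le_max_right _ _) hn
  have hth := h₂ n hn₂
  -- degenerate sizes: volume ≤ n! by pairwise packing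
  have hpackTU := card_mul_card_le_factorial hTU
  have hpackUS := card_mul_card_le_factorial hUS
  have hpackST := card_mul_card_le_factorial hST
  rcases le_or_gt S.card 1 with hS1 | hS1
  · have hV : S.card * T.card * U.card ≤ n.factorial := by
      calc S.card * T.card * U.card ≤ 1 * T.card * U.card := by gcongr
        _ = T.card * U.card := by ring
        _ ≤ n.factorial := hpackTU
    have hV' : ((S.card * T.card * U.card : ℕ) : ℝ) ≤ (n.factorial : ℝ) := by exact_mod_cast hV
    linarith
  rcases le_or_gt T.card 1 with hT1 | hT1
  · have hV : S.card * T.card * U.card ≤ n.factorial := by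
      calc S.card * T.card * U.card ≤ S.card * 1 * U.card := by gcongr
        _ = U.card * S.card := by ring
        _ ≤ n.factorial := hpackUS
    have hV' : ((S.card * T.card * U.card : ℕ) : ℝ) ≤ (n.factorial : ℝ) := by exact_mod_cast hV
    linarith
  rcases le_or_gt U.card 1 with hU1 | hU1
  · have hV : S.card * T.card * U.card ≤ n.factorial := by
      calc S.card * T.card * U.card ≤ S.card * T.card * 1 := by gcongr
        _ = S.card * T.card := by ring
        _ ≤ n.factorial := hpackST
    have hV' : ((S.card * T.card * U.card : ℕ) : ℝ) ≤ (n.factorial : ℝ) := by exact_mod_cast hV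
    linarith
  -- generic sizes: the block-structured volume bound and the asymptotics
  have hvolN := volume_mul_factorial_le_of_blockStructured S T U B lS lT lU hBS hBT hBU hlS hlT hlU
    h3 hS1 hT1 hU1
  have hle := h₁ n hn₁ (S.card * T.card * U.card) B hB hvolN
  push_cast at hle hvol
  linarith

end Final

end Summit.MatrixMultiplication.MatrixMultiplication.Theorems.ThresholdSubsetTriples.Negative
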